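import Summits.ABC.IUTFork.Conditional.WRowFrey283UnconditionalThirteen
import Summits.ABC.IUTFork.Conditional.WRowFrey283UnconditionalSeventeen
import Summits.ABC.IUTFork.Conditional.WRowFrey283UnconditionalNineteen
import Summits.ABC.IUTFork.Conditional.WRowFrey301327048Unconditional
import Summits.ABC.IUTFork.Conditional.AbcOfSGenuineKLicence
import Summits.ABC.IUTFork.Cor312ThetaSideClosedK
import Summits.ABC.IUTFork.Cor312SettingDHVolWitness
import Summits.ABC.IUTFork.Cor312ProvKIdeles
import HarnessLib

/-!
# Branch C — the NUMBER-LEVEL typed [IUTchIII] Cor. 3.12 in READING (U) (`T.Cor312Of`) EVALUATES TRUE, with NO hypothesis, at every genuine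
# Θ-volume datum of the abc triple `283 + 5¹¹·13² = 2⁸·3⁸·17³` at `l = 13, 17, 19` and of `1 + 3¹⁶·7 = 2³·11·23·53³` at `l = 23`

C scoreboard (abc-iut-C-cert-3 gen 4, INTAKE / CERTS pen). PROOF-ONLY junction file (no `def`, no new `Prop`, no instance, no notation; nothing
re-typed). WHY: abc-iut-W-row-1 gen 2 decided the four W1 OPEN-10 rows 1–4 on the INHABITED side UNCONDITIONALLY — the hull licence S_H
(`Thm311ToCor312.Licence`) HOLDS at the K-level genuine sharp setting of EVERY genuine Θ-volume datum `T` over these (datum, l), for EVERY choice of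
the free context binders and EVERY pair of realising Θ- and q-ideles (`WRow.licence_frey283_thirteen_unconditional` p481397, `…_seventeen_…` p481426,
`…_nineteen_…` p481447, `WRow.licence_frey301327048_twentyThree_unconditional` p481465). The branch-C certificates turn a licence at the genuine
setting into the datum's number-level Corollary `T.Cor312Of` (`−|log(q)| ≤ −|log(Θ)|`, hull of the union) by abc-iut-C-cert-3's
`GenuineK.cor312Of_of_licence` (p435505; q-side base-change invariance + provenance) and abc-iut-s2-p6's Θ-side descent
`negLogTheta_settingPrVolSharp_pilotDataOfK_le_datum` (p447368) — the very per-datum step of the window certificates (p444039 → p460293). Since the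
conclusion does not depend on the free context binders, instantiating them at ONE-POINT context data (abc-iut-c312-7's `unitSigDH` / `unitSplitDH` /
`unitQDataDH` / `unitLatticeDH`, `M := ℚ`, empty region families) and at the realising ideles of [IUTchI] Ex. 3.2 (iv)
(`Cor312Prov.exists_realising_{q,theta}Ideles_pilotDataOfK`, p434704) gives:

* `Frey283.cor312Of_thirteen / _seventeen / _nineteen` — **`∀ T : ThetaVolumeDatumAt (ratPoint (283/8251953408)) l, T.Cor312Of`** for `l = 13, 17, 19`;
* `Frey301327048.cor312Of_twentyThree` — the same at `(ratPoint (1/301327048), 23)`.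

READING (numbers, no side): these are FOUR Szpiro-BAD (datum, l) of the letter-W table (OPEN-10 rows 1–4) — exactly the data at which the window
certificates' NUMBER binders `hNum*` / `hNumOff*` / `hNumJoint*` (K line) would otherwise have to be ASSUMED; there they are now THEOREMS. The typed
(U)-form statement `T.Cor312Of` is a STRONGER reading of [IUTchIII] Cor 3.12 than the per-image form (P) of FINDINGS §O (`Cor312PerImageOf`), and at
(283-triple, 13) the window clause S_H is INHABITED, not refuted — the opposite configuration to the §P / §Q data (3677-triple, Reyssat). This says
NOTHING about Cor 3.12 in print, derives NO height bound (the [IUTchIV] 1.10 display at a known triple carries a constant ≈ 10⁸ nats and is trivially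
consistent — the cone binder `hregBad` is untouched, C-R52), and is not a claim that abc is proved or refuted; no side taken on any author (Mochizuki /
Scholze–Stix / Joshi / Dupuy–Hilado); inhabited-as-typed ≠ true-in-print; typed ≠ proved; instantiated ≠ endorsed.
[cite: Mochizuki2012, IUTchIII Cor. 3.12 p. 173–174, Step (xi-f) p. 184; IUTchIV Thm. 1.10 p. 22–23, Cor. 2.2 (ii) proof (P5)(P7) p. 46; IUTchI Ex. 3.2 (iv) p. 71]
[cite: DupuyHilado2025, §3.3, §3.4] [claim: Mochizuki2012, status: disputed] for every IUT sentence quoted.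
-/

noncomputable section

open Set Function NumberField IsDedekindDomain

namespace Summit.ABC.IUTFork.Conditional

open Thm311 Thm311.Real Cor312 Cor312Vol Cor312Prov Literature.IUT.LogThetaLattice Literature.IUT.LogVolume
  Literature.IUT.HodgeTheaters Literature.IUT.LogVolume.ThetaData Literature.IUT.LogVolume.Cor22
open Literature.NumberTheory.NumberFields Literature.NumberTheory.GaloisRepresentations.Ultrametric
open Literature.NumberTheory.DiophantineGeometry Literature.NumberTheory.DiophantineGeometry.GenEll Summit.ABC.ABC.Theorems

/-- **`T.Cor312Of` at EVERY genuine Θ-volume datum over `(ratPoint (283/8251953408), 13)`, NO hypothesis** — abc-iut-W-row-1's unconditional licence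
(p481397) at one-point context data and the realising ideles of [IUTchI] Ex. 3.2 (iv), through `GenuineK.cor312Of_of_licence` (p435505) and the
K-level Θ-side descent (p447368). [cite: Mochizuki2012, IUTchIII Cor. 3.12 p. 173–174; IUTchIV Cor. 2.2 (ii) proof (P5) p. 46] [claim: Mochizuki2012, status: disputed] -/
theorem Frey283.cor312Of_thirteen (T : Cor22.ThetaVolumeDatumAt (ratPoint ((283 : ℚ) / 8251953408)) 13) : T.Cor312Of := by
  letI := T.instFieldF; letI := T.instNumberFieldF; letI := T.instAlgebraF; letI := T.instFieldK
  letI := T.instNumberFieldK; letI := T.instAlgebraK; letI := T.instFieldFbar; letI := T.instAlgebraFbar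
  letI := T.instAlgebraKFbar; letI := T.instIsElliptic
  obtain ⟨tq, htq0, htq1, htq⟩ := exists_realising_qIdeles_pilotDataOfK T.D
  obtain ⟨t, ht0, ht1, ht⟩ := exists_realising_thetaIdeles_pilotDataOfK T.D
  exact GenuineK.cor312Of_of_licence T.D T.K ℚ (fun _ _ => ∅) (fun _ _ => ∅) (fun _ _ _ => ∅) (fun _ _ _ => 0) (fun _ _ => ∅)
    (fun _ _ _ _ => ∅) 0 unitLatticeDH (unitSigDH (pilotDataOfK T.D T.K)) (unitSplitDH (pilotDataOfK T.D T.K))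
    (unitQDataDH (pilotDataOfK T.D T.K)) t tq T.isVolumeInputOf htq0 htq1 ht0 ht1 htq
    (WRow.licence_frey283_thirteen_unconditional T (logvAnalytic_analyticLogv (F := T.K)) ℚ (fun _ _ => ∅) (fun _ _ => ∅) (fun _ _ _ => ∅)
      (fun _ _ _ => 0) (fun _ _ => ∅) (fun _ _ _ _ => ∅) 0 unitLatticeDH (unitSigDH (pilotDataOfK T.D T.K)) (unitSplitDH (pilotDataOfK T.D T.K))
      (unitQDataDH (pilotDataOfK T.D T.K)) tq t htq0 htq1 ht0 ht htq)
    (negLogTheta_settingPrVolSharp_pilotDataOfK_le_datum T ℚ (fun _ _ => ∅) (fun _ _ => ∅) (fun _ _ _ => ∅) (fun _ _ _ => 0) (fun _ _ => ∅)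
      (fun _ _ _ _ => ∅) 0 unitLatticeDH (unitSigDH (pilotDataOfK T.D T.K)) (unitSplitDH (pilotDataOfK T.D T.K)) (unitQDataDH (pilotDataOfK T.D T.K))
      tq t htq0 htq1 ht0 ht)

/-- **`T.Cor312Of` at EVERY genuine Θ-volume datum over `(ratPoint (283/8251953408), 17)`, NO hypothesis** — abc-iut-W-row-1's unconditional licence
(p481426) at one-point context data and the realising ideles of [IUTchI] Ex. 3.2 (iv), through `GenuineK.cor312Of_of_licence` (p435505) and the
K-level Θ-side descent (p447368). [cite: Mochizuki2012, IUTchIII Cor. 3.12 p. 173–174; IUTchIV Cor. 2.2 (ii) proof (P5) p. 46] [claim: Mochizuki2012, status: disputed] -/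
theorem Frey283.cor312Of_seventeen (T : Cor22.ThetaVolumeDatumAt (ratPoint ((283 : ℚ) / 8251953408)) 17) : T.Cor312Of := by
  letI := T.instFieldF; letI := T.instNumberFieldF; letI := T.instAlgebraF; letI := T.instFieldK
  letI := T.instNumberFieldK; letI := T.instAlgebraK; letI := T.instFieldFbar; letI := T.instAlgebraFbar
  letI := T.instAlgebraKFbar; letI := T.instIsElliptic
  obtain ⟨tq, htq0, htq1, htq⟩ := exists_realising_qIdeles_pilotDataOfK T.D
  obtain ⟨t, ht0, ht1, ht⟩ := exists_realising_thetaIdeles_pilotDataOfK T.D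
  exact GenuineK.cor312Of_of_licence T.D T.K ℚ (fun _ _ => ∅) (fun _ _ => ∅) (fun _ _ _ => ∅) (fun _ _ _ => 0) (fun _ _ => ∅)
    (fun _ _ _ _ => ∅) 0 unitLatticeDH (unitSigDH (pilotDataOfK T.D T.K)) (unitSplitDH (pilotDataOfK T.D T.K))
    (unitQDataDH (pilotDataOfK T.D T.K)) t tq T.isVolumeInputOf htq0 htq1 ht0 ht1 htq
    (WRow.licence_frey283_seventeen_unconditional T (logvAnalytic_analyticLogv (F := T.K)) ℚ (fun _ _ => ∅) (fun _ _ => ∅) (fun _ _ _ => ∅)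
      (fun _ _ _ => 0) (fun _ _ => ∅) (fun _ _ _ _ => ∅) 0 unitLatticeDH (unitSigDH (pilotDataOfK T.D T.K)) (unitSplitDH (pilotDataOfK T.D T.K))
      (unitQDataDH (pilotDataOfK T.D T.K)) tq t htq0 htq1 ht0 ht htq)
    (negLogTheta_settingPrVolSharp_pilotDataOfK_le_datum T ℚ (fun _ _ => ∅) (fun _ _ => ∅) (fun _ _ _ => ∅) (fun _ _ _ => 0) (fun _ _ => ∅)
      (fun _ _ _ _ => ∅) 0 unitLatticeDH (unitSigDH (pilotDataOfK T.D T.K)) (unitSplitDH (pilotDataOfK T.D T.K)) (unitQDataDH (pilotDataOfK T.D T.K))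
      tq t htq0 htq1 ht0 ht)

/-- **`T.Cor312Of` at EVERY genuine Θ-volume datum over `(ratPoint (283/8251953408), 19)`, NO hypothesis** — abc-iut-W-row-1's unconditional licence
(p481447) at one-point context data and the realising ideles of [IUTchI] Ex. 3.2 (iv), through `GenuineK.cor312Of_of_licence` (p435505) and the
K-level Θ-side descent (p447368). [cite: Mochizuki2012, IUTchIII Cor. 3.12 p. 173–174; IUTchIV Cor. 2.2 (ii) proof (P5) p. 46] [claim: Mochizuki2012, status: disputed] -/
theorem Frey283.cor312Of_nineteen (T : Cor22.ThetaVolumeDatumAt (ratPoint ((283 : ℚ) / 8251953408)) 19) : T.Cor312Of := by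
  letI := T.instFieldF; letI := T.instNumberFieldF; letI := T.instAlgebraF; letI := T.instFieldK
  letI := T.instNumberFieldK; letI := T.instAlgebraK; letI := T.instFieldFbar; letI := T.instAlgebraFbar
  letI := T.instAlgebraKFbar; letI := T.instIsElliptic
  obtain ⟨tq, htq0, htq1, htq⟩ := exists_realising_qIdeles_pilotDataOfK T.D
  obtain ⟨t, ht0, ht1, ht⟩ := exists_realising_thetaIdeles_pilotDataOfK T.D
  exact GenuineK.cor312Of_of_licence T.D T.K ℚ (fun _ _ => ∅) (fun _ _ => ∅) (fun _ _ _ => ∅) (fun _ _ _ => 0) (fun _ _ => ∅)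
    (fun _ _ _ _ => ∅) 0 unitLatticeDH (unitSigDH (pilotDataOfK T.D T.K)) (unitSplitDH (pilotDataOfK T.D T.K))
    (unitQDataDH (pilotDataOfK T.D T.K)) t tq T.isVolumeInputOf htq0 htq1 ht0 ht1 htq
    (WRow.licence_frey283_nineteen_unconditional T (logvAnalytic_analyticLogv (F := T.K)) ℚ (fun _ _ => ∅) (fun _ _ => ∅) (fun _ _ _ => ∅)
      (fun _ _ _ => 0) (fun _ _ => ∅) (fun _ _ _ _ => ∅) 0 unitLatticeDH (unitSigDH (pilotDataOfK T.D T.K)) (unitSplitDH (pilotDataOfK T.D T.K))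
      (unitQDataDH (pilotDataOfK T.D T.K)) tq t htq0 htq1 ht0 ht htq)
    (negLogTheta_settingPrVolSharp_pilotDataOfK_le_datum T ℚ (fun _ _ => ∅) (fun _ _ => ∅) (fun _ _ _ => ∅) (fun _ _ _ => 0) (fun _ _ => ∅)
      (fun _ _ _ _ => ∅) 0 unitLatticeDH (unitSigDH (pilotDataOfK T.D T.K)) (unitSplitDH (pilotDataOfK T.D T.K)) (unitQDataDH (pilotDataOfK T.D T.K))
      tq t htq0 htq1 ht0 ht)

/-- **`T.Cor312Of` at EVERY genuine Θ-volume datum over `(ratPoint (1/301327048), 23)`, NO hypothesis** — abc-iut-W-row-1's unconditional licence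
(p481465) at one-point context data and the realising ideles of [IUTchI] Ex. 3.2 (iv), through `GenuineK.cor312Of_of_licence` (p435505) and the
K-level Θ-side descent (p447368). [cite: Mochizuki2012, IUTchIII Cor. 3.12 p. 173–174; IUTchIV Cor. 2.2 (ii) proof (P5) p. 46] [claim: Mochizuki2012, status: disputed] -/
theorem Frey301327048.cor312Of_twentyThree (T : Cor22.ThetaVolumeDatumAt (ratPoint ((1 : ℚ) / 301327048)) 23) : T.Cor312Of := by
  letI := T.instFieldF; letI := T.instNumberFieldF; letI := T.instAlgebraF; letI := T.instFieldK
  letI := T.instNumberFieldK; letI := T.instAlgebraK; letI := T.instFieldFbar; letI := T.instAlgebraFbar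
  letI := T.instAlgebraKFbar; letI := T.instIsElliptic
  obtain ⟨tq, htq0, htq1, htq⟩ := exists_realising_qIdeles_pilotDataOfK T.D
  obtain ⟨t, ht0, ht1, ht⟩ := exists_realising_thetaIdeles_pilotDataOfK T.D
  exact GenuineK.cor312Of_of_licence T.D T.K ℚ (fun _ _ => ∅) (fun _ _ => ∅) (fun _ _ _ => ∅) (fun _ _ _ => 0) (fun _ _ => ∅)
    (fun _ _ _ _ => ∅) 0 unitLatticeDH (unitSigDH (pilotDataOfK T.D T.K)) (unitSplitDH (pilotDataOfK T.D T.K))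
    (unitQDataDH (pilotDataOfK T.D T.K)) t tq T.isVolumeInputOf htq0 htq1 ht0 ht1 htq
    (WRow.licence_frey301327048_twentyThree_unconditional T (logvAnalytic_analyticLogv (F := T.K)) ℚ (fun _ _ => ∅) (fun _ _ => ∅) (fun _ _ _ => ∅)
      (fun _ _ _ => 0) (fun _ _ => ∅) (fun _ _ _ _ => ∅) 0 unitLatticeDH (unitSigDH (pilotDataOfK T.D T.K)) (unitSplitDH (pilotDataOfK T.D T.K))
      (unitQDataDH (pilotDataOfK T.D T.K)) tq t htq0 htq1 ht0 ht htq)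
    (negLogTheta_settingPrVolSharp_pilotDataOfK_le_datum T ℚ (fun _ _ => ∅) (fun _ _ => ∅) (fun _ _ _ => ∅) (fun _ _ _ => 0) (fun _ _ => ∅)
      (fun _ _ _ _ => ∅) 0 unitLatticeDH (unitSigDH (pilotDataOfK T.D T.K)) (unitSplitDH (pilotDataOfK T.D T.K)) (unitQDataDH (pilotDataOfK T.D T.K))
      tq t htq0 htq1 ht0 ht)

end Summit.ABC.IUTFork.Conditional

end
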